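/-
Copyright: the b2b-balaban T⁴-continuum CRUX team, row NE7b leaf lineage `t4-ne7b-formalise-leaf-04` (gen 151). Project licence.
-/
import Summits.QuantumFields.BalabanUV.T4Continuum.Spine.NE7b.StrongConvexSubgradientField
import Mathlib.Analysis.Convex.Continuous

/-!
# THE BACKGROUND FIELD OF THE SOFT STEP IS LIPSCHITZ IN THE KEPT VARIABLE FROM `σ` ALONE: the minimiser `y₀(x)` of
# `y ↦ S y + a‖x − P y‖²` obeys `‖y₀(x) − y₀(x′)‖ ≤ (2aκ∕σ)‖x − x′‖` for `σ`-strongly convex `S` and `‖P y‖ ≤ κ‖y‖` — no derivative of `S`,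
# no implicit function; through the DERIVATIVE-FREE stability lemma «two functionals with quadratic growth `m` at their minimisers that
# differ by a tilt have minimisers within (size of the tilt)∕m» (row NE7b, node U5c; residual (R2′) family (2), letters (ℓ3)∕(ℓ4) —
# centring ∕ identification of the background — through a CLASSICAL soft step; [folklore] convex analysis)

Cell `pub-balaban`, sub-cell `t4`, spine estimate NE7b (`T4WeightBudget.RelWeightBound`; the cell's OWN estimate — NOT PRINTED in
[Bałaban 1983–89], NOT PROVED).  Crux-route work under `Spine/NE7b/` by leaf-04 on the convexity road; NOTHING of Bałaban's is named or
asserted; no `T4Continuum/Support` leaf typed; no `def`; zero `sorry`.  Imports: this road's BUILT `…StrongConvexSubgradientField` (§4 only: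
a strong subgradient at one point makes the soft functional coercive) and Mathlib (`Analysis.Convex.Continuous` for the continuity of a
finite convex function in finite dimension) — fast lane.

WHY.  The soft averaging step of the road has value `ψ(x) = min_y [S y + a‖x − P y‖²]` (`…SoftConstraintEnvelope` (SCE): a Moreau
envelope of the hard value, `C¹` by `…MoreauEnvelopeLetters`) and BACKGROUND FIELD `y₀(x)` = the minimiser.  Read in the kept variable,
`P y₀(x) = prox_{φ∕(2a)} x` is a `C¹` contraction (SCE §2 ∕ `…MoreauProxJacobian`, the latter asking `C²`).  Print's steps need the
background field ITSELF — in the FINE variable — to depend controllably on the coarse variable (the chart is centred at it: letters (ℓ3)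
centring ∕ (ℓ4) identification of the OWNER's family (2)); the tree's minimiser-stability letters ask a GRADIENT
(`…ConvexWindowMinimiser` §2 `λ‖x⋆ − x₀‖ ≤ ‖∇V x₀‖`, `…ConvexMinimiser` §2) or `C²` + the implicit function (MPJ, leaf-03's
`…ConstrainedValueSection`).  THIS FILE gives the Lipschitz dependence from STRONG CONVEXITY ALONE: (§1) an `m`-strongly convex function
grows quadratically away from a minimiser on any convex set (`f x₀ + (m∕2)‖y − x₀‖² ≤ f y` — no derivative); (§2) two functionals with
that growth at their respective minimisers `x₁`, `x₂` obey `m‖x₁ − x₂‖² ≤ (f − g)(x₂) − (f − g)(x₁)`, so an `L`-Lipschitz perturbation moves the minimiser by at most `L∕m` and a linear tilt `⟪h, ·⟫`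
by at most `‖h‖∕m` (the classical twin of the tilted-MEAN shift `‖∇V x₀‖∕λ` of `…ConvexWindowMinimiserTilted`, derivative-free);
(§3) the soft functionals at `x` and `x′` differ by the tilt `y ↦ −2a⟪x − x′, P y⟫` (+ a constant), whence
`‖y₀(x) − y₀(x′)‖ ≤ (2aκ∕σ)‖x − x′‖`, uniqueness of `y₀(x)`, and `‖P y₀(x) − P y₀(x′)‖ ≤ (2aκ²∕σ)‖x − x′‖` (MEL's sharper
`(1 + σ∕(2aκ²))⁻¹` needs the prox structure; this one needs nothing); (§4) EXISTENCE of `y₀(x)` in finite dimension from `σ > 0` alone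
(a strong subgradient at `0` — `…StrongConvexSubgradientField` §1 BY NAME — makes the functional coercive; a finite convex function is
continuous), so SCE's displayed hypothesis «`y₀` a soft minimiser» is discharged for strongly convex `S`.

WHAT IS PROVED ([folklore]; Bonnans–Shapiro, *Perturbation Analysis of Optimization Problems* (2000) Prop. 4.32 (second-order growth ⟹
Lipschitz stability of minimisers); Dontchev–Rockafellar (2009) §2; proved here from Mathlib's `StrongConvexOn` letter, nothing cited as a fact):
* §1 **`growth_of_isMinOn`** (`StrongConvexOn K m f`, `x₀ ∈ K` minimises `f` on `K` ⟹ `f x₀ + (m∕2)‖y − x₀‖² ≤ f y` on `K` — the secant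
  letter between `y` and `x₀` at weight `t → 0⁺`, closed by an algebraic choice of `t`, no limit), `eq_of_isMinOn_of_isMinOn` (`m > 0`: the
  minimiser is unique), `strongConvexOn_add_convexOn` (`m`-strongly convex + convex = `m`-strongly convex).
* §2 STABILITY: **`mul_norm_sub_sq_le_of_growth`** (`m‖x₁ − x₂‖² ≤ (f x₂ − g x₂) − (f x₁ − g x₁)` from the two growth letters on `K`),
  **`norm_sub_le_of_growth_of_lipschitz`** (`f − g` `L`-Lipschitz on `K`, `0 ≤ L`, `m > 0` ⟹ `‖x₁ − x₂‖ ≤ L∕m`),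
  **`norm_sub_le_of_growth_of_tilt`** (inner product space: `g = f + ⟪h, ·⟫ + c` ⟹ `‖x₁ − x₂‖ ≤ ‖h‖∕m`).
* §3 THE SOFT STEP (`F` a real inner product space, `P : E →ₗ[ℝ] F` with `‖P y‖ ≤ κ‖y‖`, `0 ≤ a`): `norm_convexComb_sq` (the parallelogram
  letter `‖t u + s v‖² = t‖u‖² + s‖v‖² − ts‖u − v‖²`, `t + s = 1`), `convexOn_softPenalty` (`y ↦ a‖x − P y‖²` is convex),
  **`strongConvexOn_softFunctional`** (`StrongConvexOn univ σ S ⟹ StrongConvexOn univ σ (y ↦ S y + a‖x − P y‖²)`), `softFunctional_sub`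
  (the two functionals differ by `a(‖x‖² − ‖x′‖²) − 2a⟪x − x′, P y⟫`), **`norm_sub_le_of_isMinOn_soft`** (THE END:
  `‖y₀ − y₀′‖ ≤ (2aκ∕σ)‖x − x′‖` for minimisers `y₀`, `y₀′` of the soft functionals at `x`, `x′`; `0 < σ`, `0 ≤ κ`),
  `eq_of_isMinOn_soft` (uniqueness), `norm_apply_sub_le_of_isMinOn_soft` (`‖P y₀ − P y₀′‖ ≤ (2aκ²∕σ)‖x − x′‖`).
* §4 EXISTENCE (`E` a finite-dimensional real inner product space, `0 < σ`): `tendsto_of_strongSubgradient` (a strong letter at one point ⟹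
  `Tendsto f (cocompact E) atTop`), **`exists_isMinOn_of_strongConvexOn`** (an `m`-strongly convex function on `univ`, `m > 0`, attains its
  minimum — continuity from Mathlib's `ConvexOn.continuousOn`, coercivity from `…StrongConvexSubgradientField` §1),
  **`exists_isMinOn_soft`** (the soft background field EXISTS at every `x`), `existsUnique_isMinOn_soft`.
* §5 toy (kernel): `S = ½σ‖·‖²`-type check that the letters are jointly inhabited (`example` on `P = id`).

NOT HERE (honest): the sharp constant through the prox structure (`‖P y₀ − P y₀′‖ ≤ (1 + σ∕(2aκ²))⁻¹‖x − x′‖`, MEL §5b ∘ SCE §2); windows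
(`S` strongly convex on a convex `K` only: §1–§2 are stated ON `K`, §3–§4 on `univ` — the windowed soft step needs the minimiser to stay
inside, the road's margin letters); differentiability of `x ↦ y₀(x)` (MPJ ∕ leaf-03's section, `C²`); the HARD step's background (needs a
right inverse and an upper letter — `…ConstrainedValueGrowth` currency); which `S, P, a` of Bałaban's ((A3) ∕ (A1c), NC-NE7b-α UNRULED);
anything of Bałaban's.  BY-NAME EFFECT ON THE WALL: NONE.  NE7b NOT PRINTED ∕ NOT PROVED; spine PROVED 0∕9; rung (B)+1 on a FINITE torus —
NOT infinite volume, NOT the mass gap, NOT Clay.  HONEST DEPENDENCY: continuum YM on T⁴ ⇐ BetaPertH ∧ nine spine estimates (0/9 proved);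
BetaPertH ⇐ (D1) ∧ (D4) ∧ CAP+tail; G-an2-4 gates asym, D1 and NE2∕3∕4.
-/

set_option autoImplicit false

noncomputable section

namespace Summit.QuantumFields.BalabanUV.T4Continuum.NE7b.SoftStepBackgroundLipschitz

open Set Filter Topology
open scoped RealInnerProductSpace
open Summit.QuantumFields.BalabanUV.T4Continuum.NE7b.StrongConvexSubgradientField

/-! ## §1 Quadratic growth at a minimiser of a strongly convex function — no derivative -/

section Growth

variable {E : Type*} [NormedAddCommGroup E] [NormedSpace ℝ E]

/-- **QUADRATIC GROWTH AT A MINIMISER**: `f` `m`-strongly convex on a convex `K`, `x₀ ∈ K` a minimiser of `f` on `K` ⟹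
`f x₀ + (m∕2)‖y − x₀‖² ≤ f y` for every `y ∈ K`.  Proof: the secant letter between `y` and `x₀` at weight `t ∈ (0,1)` and minimality at
`t•y + (1−t)•x₀` give `(1 − t)(m∕2)‖y − x₀‖² ≤ f y − f x₀`; an algebraic choice of `t` closes it (no limit taken). [folklore] -/
theorem growth_of_isMinOn {K : Set E} {m : ℝ} {f : E → ℝ} (hf : StrongConvexOn K m f) {x₀ : E} (hx₀ : x₀ ∈ K)
    (hmin : IsMinOn f K x₀) {y : E} (hy : y ∈ K) : f x₀ + m / 2 * ‖y - x₀‖ ^ 2 ≤ f y := by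
  -- the letter at weight `t`
  have key : ∀ t : ℝ, 0 < t → t < 1 → (1 - t) * (m / 2 * ‖y - x₀‖ ^ 2) ≤ f y - f x₀ := by
    intro t ht0 ht1
    have hsec := hf.2 hy hx₀ ht0.le (by linarith : 0 ≤ 1 - t) (by ring : t + (1 - t) = 1)
    have hmem : t • y + (1 - t) • x₀ ∈ K := hf.1 hy hx₀ ht0.le (by linarith) (by ring)
    have hm := hmin hmem
    rw [mem_setOf_eq] at hm
    simp only [smul_eq_mul] at hsec
    -- `t (f y − f x₀) ≥ t (1 − t) (m∕2) ‖y − x₀‖²`, divide by `t > 0`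
    have h1 : t * ((1 - t) * (m / 2 * ‖y - x₀‖ ^ 2)) ≤ t * (f y - f x₀) := by nlinarith
    exact le_of_mul_le_mul_left h1 ht0
  have hD : 0 ≤ f y - f x₀ := by have := hmin hy; rw [mem_setOf_eq] at this; linarith
  set c : ℝ := m / 2 * ‖y - x₀‖ ^ 2 with hc
  by_contra hlt
  have hlt' : f y - f x₀ < c := by linarith
  have hcpos : 0 < c := lt_of_le_of_lt hD hlt'
  -- choose `t = (c − D)∕(2c) ∈ (0, 1)`: then `(1 − t) c = (c + D)∕2 > D`
  have ht0 : 0 < (c - (f y - f x₀)) / (2 * c) := div_pos (by linarith) (by linarith)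
  have ht1 : (c - (f y - f x₀)) / (2 * c) < 1 := by
    rw [div_lt_one (by linarith)]; linarith
  have h := key _ ht0 ht1
  have e : (1 - (c - (f y - f x₀)) / (2 * c)) * c = (c + (f y - f x₀)) / 2 := by
    field_simp
    ring
  rw [e] at h
  linarith

/-- **THE MINIMISER OF A STRONGLY CONVEX FUNCTION IS UNIQUE** (`m > 0`). [folklore] -/
theorem eq_of_isMinOn_of_isMinOn {K : Set E} {m : ℝ} (hm : 0 < m) {f : E → ℝ} (hf : StrongConvexOn K m f) {x₁ x₂ : E}
    (hx₁ : x₁ ∈ K) (hx₂ : x₂ ∈ K) (h₁ : IsMinOn f K x₁) (h₂ : IsMinOn f K x₂) : x₁ = x₂ := by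
  have g₁ := growth_of_isMinOn hf hx₁ h₁ hx₂
  have g₂ := growth_of_isMinOn hf hx₂ h₂ hx₁
  rw [norm_sub_rev] at g₂
  have h0 : m * ‖x₂ - x₁‖ ^ 2 ≤ 0 := by linarith
  have h1 : ‖x₂ - x₁‖ ^ 2 ≤ 0 := by
    rcases (sq_nonneg ‖x₂ - x₁‖).eq_or_lt with h | h
    · exact h.symm.le
    · exact absurd h0 (not_le.2 (mul_pos hm h))
  have h2 : ‖x₂ - x₁‖ = 0 := pow_eq_zero_iff two_ne_zero |>.1 (le_antisymm h1 (sq_nonneg _))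
  exact (eq_of_sub_eq_zero (norm_eq_zero.1 h2)).symm

/-- `m`-strongly convex plus convex is `m`-strongly convex (Mathlib's `UniformConvexOn.add` with the zero modulus). [folklore] -/
theorem strongConvexOn_add_convexOn {K : Set E} {m : ℝ} {f g : E → ℝ} (hf : StrongConvexOn K m f) (hg : ConvexOn ℝ K g) :
    StrongConvexOn K m (fun y => f y + g y) := by
  have h := UniformConvexOn.add hf (uniformConvexOn_zero.2 hg)
  refine ⟨h.1, fun x hx y hy a b ha hb hab => ?_⟩
  have := h.2 hx hy ha hb hab
  simpa using this

end Growth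

/-! ## §2 Stability: two functionals with quadratic growth at their minimisers that differ by a perturbation -/

section Stability

variable {E : Type*} [NormedAddCommGroup E]

/-- **THE STABILITY LETTER**: if `f` grows quadratically (`m`) from `x₁` on `K` and `g` from `x₂` on `K` (`x₁, x₂ ∈ K`), then
`m‖x₁ − x₂‖² ≤ (f x₂ − g x₂) − (f x₁ − g x₁)` — test each growth letter at the other's minimiser and add. [folklore] -/
theorem mul_norm_sub_sq_le_of_growth {K : Set E} {m : ℝ} {f g : E → ℝ} {x₁ x₂ : E} (hx₁ : x₁ ∈ K) (hx₂ : x₂ ∈ K)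
    (h₁ : ∀ y ∈ K, f x₁ + m / 2 * ‖y - x₁‖ ^ 2 ≤ f y) (h₂ : ∀ y ∈ K, g x₂ + m / 2 * ‖y - x₂‖ ^ 2 ≤ g y) :
    m * ‖x₁ - x₂‖ ^ 2 ≤ (f x₂ - g x₂) - (f x₁ - g x₁) := by
  have a := h₁ x₂ hx₂
  have b := h₂ x₁ hx₁
  rw [norm_sub_rev] at a
  linarith

/-- **AN `L`-LIPSCHITZ PERTURBATION MOVES THE MINIMISER BY AT MOST `L∕m`**: with the two growth letters (`m > 0`) and
`|(f − g) u − (f − g) v| ≤ L‖u − v‖` on `K` ⟹ `‖x₁ − x₂‖ ≤ L∕m`. [folklore] -/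
theorem norm_sub_le_of_growth_of_lipschitz {K : Set E} {m L : ℝ} (hm : 0 < m) (hL0 : 0 ≤ L) {f g : E → ℝ} {x₁ x₂ : E}
    (hx₁ : x₁ ∈ K) (hx₂ : x₂ ∈ K) (h₁ : ∀ y ∈ K, f x₁ + m / 2 * ‖y - x₁‖ ^ 2 ≤ f y)
    (h₂ : ∀ y ∈ K, g x₂ + m / 2 * ‖y - x₂‖ ^ 2 ≤ g y)
    (hL : ∀ u ∈ K, ∀ v ∈ K, |(f u - g u) - (f v - g v)| ≤ L * ‖u - v‖) : ‖x₁ - x₂‖ ≤ L / m := by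
  have h := mul_norm_sub_sq_le_of_growth hx₁ hx₂ h₁ h₂
  have hl := (abs_le.1 (hL x₂ hx₂ x₁ hx₁)).2
  rw [norm_sub_rev] at hl
  have h3 : m * ‖x₁ - x₂‖ ^ 2 ≤ L * ‖x₁ - x₂‖ := h.trans hl
  rw [le_div_iff₀ hm]
  by_cases h0 : ‖x₁ - x₂‖ = 0
  · rw [h0, zero_mul]; exact hL0
  · have hpos : 0 < ‖x₁ - x₂‖ := lt_of_le_of_ne (norm_nonneg _) (Ne.symm h0)
    have h4 : (‖x₁ - x₂‖ * m) * ‖x₁ - x₂‖ ≤ L * ‖x₁ - x₂‖ := by nlinarith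
    exact le_of_mul_le_mul_right h4 hpos

end Stability

section Tilt

variable {E : Type*} [NormedAddCommGroup E] [InnerProductSpace ℝ E]

/-- **A LINEAR TILT MOVES THE MINIMISER BY AT MOST `‖h‖∕m`**: `g = f + ⟪h, ·⟫ + c` on `K` with the two growth letters (`m > 0`) ⟹
`‖x₁ − x₂‖ ≤ ‖h‖∕m` — the classical (minimiser) twin of the tilted-mean shift, with no derivative of `f`. [folklore] -/
theorem norm_sub_le_of_growth_of_tilt {K : Set E} {m : ℝ} (hm : 0 < m) {f g : E → ℝ} {h : E} {c : ℝ} {x₁ x₂ : E}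
    (hx₁ : x₁ ∈ K) (hx₂ : x₂ ∈ K) (hfg : ∀ y ∈ K, g y = f y + ⟪h, y⟫ + c)
    (h₁ : ∀ y ∈ K, f x₁ + m / 2 * ‖y - x₁‖ ^ 2 ≤ f y) (h₂ : ∀ y ∈ K, g x₂ + m / 2 * ‖y - x₂‖ ^ 2 ≤ g y) :
    ‖x₁ - x₂‖ ≤ ‖h‖ / m := by
  refine norm_sub_le_of_growth_of_lipschitz hm (norm_nonneg h) hx₁ hx₂ h₁ h₂ fun u hu v hv => ?_
  rw [hfg u hu, hfg v hv]
  have e : f u - (f u + ⟪h, u⟫ + c) - (f v - (f v + ⟪h, v⟫ + c)) = -⟪h, u - v⟫ := by rw [inner_sub_right]; ring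
  rw [e, abs_neg]
  exact abs_real_inner_le_norm h (u - v)

end Tilt

/-! ## §3 The soft step: `y ↦ S y + a‖x − P y‖²` at two kept points differ by a tilt of size `2aκ‖x − x′‖` -/

section Soft

variable {E F : Type*} [NormedAddCommGroup E] [NormedSpace ℝ E] [NormedAddCommGroup F] [InnerProductSpace ℝ F]

omit [NormedSpace ℝ E] in
/-- The parallelogram letter behind the convexity of a squared distance: `t + s = 1` ⟹
`‖t•u + s•v‖² = t‖u‖² + s‖v‖² − t·s·‖u − v‖²`. [folklore] -/
theorem norm_convexComb_sq (u v : F) {t s : ℝ} (hts : t + s = 1) :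
    ‖t • u + s • v‖ ^ 2 = t * ‖u‖ ^ 2 + s * ‖v‖ ^ 2 - t * s * ‖u - v‖ ^ 2 := by
  have hs : s = 1 - t := by linarith
  subst hs
  rw [norm_add_sq_real, norm_sub_sq_real, norm_smul, norm_smul, inner_smul_left, inner_smul_right, Real.norm_eq_abs,
    Real.norm_eq_abs, mul_pow, mul_pow, sq_abs, sq_abs]
  simp only [RCLike.conj_to_real]
  ring

/-- **THE PENALTY IS CONVEX IN THE FINE VARIABLE**: `y ↦ a‖x − P y‖²` is convex on `univ` for `0 ≤ a` and `P` linear. [folklore] -/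
theorem convexOn_softPenalty (P : E →ₗ[ℝ] F) {a : ℝ} (ha : 0 ≤ a) (x : F) :
    ConvexOn ℝ univ fun y : E => a * ‖x - P y‖ ^ 2 := by
  refine ⟨convex_univ, fun y₁ _ y₂ _ t s ht hs hts => ?_⟩
  simp only [smul_eq_mul]
  have hx : (t + s) • x = x := by rw [hts, one_smul]
  have e : x - P (t • y₁ + s • y₂) = t • (x - P y₁) + s • (x - P y₂) := by
    rw [map_add, map_smul, map_smul, smul_sub, smul_sub]
    nth_rewrite 1 [← hx]
    rw [add_smul]
    abel
  rw [e, norm_convexComb_sq _ _ hts]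
  have hnn : 0 ≤ t * s * ‖(x - P y₁) - (x - P y₂)‖ ^ 2 := by positivity
  nlinarith

/-- **THE SOFT FUNCTIONAL INHERITS `S`'s MODULUS**: `StrongConvexOn univ σ S`, `0 ≤ a` ⟹ `y ↦ S y + a‖x − P y‖²` is `σ`-strongly convex on
`univ` (the penalty adds convexity and no modulus in general — `P` may have a kernel). [folklore] -/
theorem strongConvexOn_softFunctional {S : E → ℝ} {σ : ℝ} (hS : StrongConvexOn univ σ S) (P : E →ₗ[ℝ] F) {a : ℝ} (ha : 0 ≤ a)
    (x : F) : StrongConvexOn univ σ fun y => S y + a * ‖x - P y‖ ^ 2 :=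
  strongConvexOn_add_convexOn hS (convexOn_softPenalty P ha x)

/-- The two soft functionals differ by a tilt plus a constant: `(S y + a‖x − P y‖²) − (S y + a‖x′ − P y‖²) =
a(‖x‖² − ‖x′‖²) − 2a⟪x − x′, P y⟫`. [folklore] -/
theorem softFunctional_sub (S : E → ℝ) (P : E →ₗ[ℝ] F) (a : ℝ) (x x' : F) (y : E) :
    (S y + a * ‖x - P y‖ ^ 2) - (S y + a * ‖x' - P y‖ ^ 2) = a * (‖x‖ ^ 2 - ‖x'‖ ^ 2) - 2 * a * ⟪x - x', P y⟫ := by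
  rw [norm_sub_sq_real, norm_sub_sq_real, inner_sub_left]
  ring

/-- **THE END: THE SOFT BACKGROUND FIELD IS `(2aκ∕σ)`-LIPSCHITZ IN THE KEPT VARIABLE.**  `S` `σ`-strongly convex on `univ` with `σ > 0`,
`0 ≤ a`, `P` linear with `‖P y‖ ≤ κ‖y‖` (`0 ≤ κ`); `y₀` minimises `y ↦ S y + a‖x − P y‖²` and `y₀′` minimises `y ↦ S y + a‖x′ − P y‖²` ⟹
`‖y₀ − y₀′‖ ≤ (2aκ∕σ)‖x − x′‖` (§1 growth for both, §2 stability, the tilt `2a⟪x − x′, P(y₀ − y₀′)⟫ ≤ 2aκ‖x − x′‖‖y₀ − y₀′‖`).  No derivative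
of `S` is asked. [folklore] -/
theorem norm_sub_le_of_isMinOn_soft {S : E → ℝ} {σ : ℝ} (hσ : 0 < σ) (hS : StrongConvexOn univ σ S) (P : E →ₗ[ℝ] F) {κ : ℝ}
    (hκ : 0 ≤ κ) (hPκ : ∀ y, ‖P y‖ ≤ κ * ‖y‖) {a : ℝ} (ha : 0 ≤ a) {x x' : F} {y₀ y₀' : E}
    (hy₀ : IsMinOn (fun y => S y + a * ‖x - P y‖ ^ 2) univ y₀) (hy₀' : IsMinOn (fun y => S y + a * ‖x' - P y‖ ^ 2) univ y₀') :
    ‖y₀ - y₀'‖ ≤ 2 * a * κ / σ * ‖x - x'‖ := by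
  have g₁ := fun y (_ : y ∈ (univ : Set E)) => growth_of_isMinOn (strongConvexOn_softFunctional hS P ha x) (mem_univ y₀) hy₀ (mem_univ y)
  have g₂ := fun y (_ : y ∈ (univ : Set E)) =>
    growth_of_isMinOn (strongConvexOn_softFunctional hS P ha x') (mem_univ y₀') hy₀' (mem_univ y)
  have h := mul_norm_sub_sq_le_of_growth (f := fun y => S y + a * ‖x - P y‖ ^ 2) (g := fun y => S y + a * ‖x' - P y‖ ^ 2)
    (m := σ) (mem_univ y₀) (mem_univ y₀') g₁ g₂
  rw [softFunctional_sub, softFunctional_sub] at h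
  -- the constants cancel; the tilt is `2a⟪x − x′, P y₀ − P y₀′⟫ = 2a⟪x − x′, P (y₀ − y₀′)⟫`
  have e : a * (‖x‖ ^ 2 - ‖x'‖ ^ 2) - 2 * a * ⟪x - x', P y₀'⟫ - (a * (‖x‖ ^ 2 - ‖x'‖ ^ 2) - 2 * a * ⟪x - x', P y₀⟫)
      = 2 * a * ⟪x - x', P (y₀ - y₀')⟫ := by rw [map_sub, inner_sub_right]; ring
  rw [e] at h
  have hcs : ⟪x - x', P (y₀ - y₀')⟫ ≤ ‖x - x'‖ * (κ * ‖y₀ - y₀'‖) :=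
    (real_inner_le_norm _ _).trans (mul_le_mul_of_nonneg_left (hPκ _) (norm_nonneg _))
  have h3 : σ * ‖y₀ - y₀'‖ ^ 2 ≤ (2 * a * κ * ‖x - x'‖) * ‖y₀ - y₀'‖ := by nlinarith
  by_cases h0 : ‖y₀ - y₀'‖ = 0
  · rw [h0]; positivity
  · have hpos : 0 < ‖y₀ - y₀'‖ := lt_of_le_of_ne (norm_nonneg _) (Ne.symm h0)
    have h4 : σ * ‖y₀ - y₀'‖ ≤ 2 * a * κ * ‖x - x'‖ := le_of_mul_le_mul_right (by nlinarith) hpos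
    rw [div_mul_eq_mul_div, le_div_iff₀ hσ]
    linarith

/-- **UNIQUENESS OF THE SOFT BACKGROUND FIELD** (`σ > 0`): two minimisers at the same kept point coincide. [folklore] -/
theorem eq_of_isMinOn_soft {S : E → ℝ} {σ : ℝ} (hσ : 0 < σ) (hS : StrongConvexOn univ σ S) (P : E →ₗ[ℝ] F) {a : ℝ} (ha : 0 ≤ a)
    {x : F} {y₀ y₁ : E} (hy₀ : IsMinOn (fun y => S y + a * ‖x - P y‖ ^ 2) univ y₀)
    (hy₁ : IsMinOn (fun y => S y + a * ‖x - P y‖ ^ 2) univ y₁) : y₀ = y₁ :=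
  eq_of_isMinOn_of_isMinOn hσ (strongConvexOn_softFunctional hS P ha x) (mem_univ _) (mem_univ _) hy₀ hy₁

/-- **THE AVERAGED BACKGROUND IS `(2aκ²∕σ)`-LIPSCHITZ** — `‖P y₀ − P y₀′‖ ≤ (2aκ²∕σ)‖x − x′‖` (the prox structure gives the sharper contraction
`(1 + σ∕(2aκ²))⁻¹` — `…MoreauEnvelopeLetters` §5b with `…SoftConstraintEnvelope` §2; this is the derivative- and prox-free bound). [folklore] -/
theorem norm_apply_sub_le_of_isMinOn_soft {S : E → ℝ} {σ : ℝ} (hσ : 0 < σ) (hS : StrongConvexOn univ σ S) (P : E →ₗ[ℝ] F)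
    {κ : ℝ} (hκ : 0 ≤ κ) (hPκ : ∀ y, ‖P y‖ ≤ κ * ‖y‖) {a : ℝ} (ha : 0 ≤ a) {x x' : F} {y₀ y₀' : E}
    (hy₀ : IsMinOn (fun y => S y + a * ‖x - P y‖ ^ 2) univ y₀) (hy₀' : IsMinOn (fun y => S y + a * ‖x' - P y‖ ^ 2) univ y₀') :
    ‖P y₀ - P y₀'‖ ≤ 2 * a * κ ^ 2 / σ * ‖x - x'‖ := by
  have h := norm_sub_le_of_isMinOn_soft hσ hS P hκ hPκ ha hy₀ hy₀'
  calc ‖P y₀ - P y₀'‖ = ‖P (y₀ - y₀')‖ := by rw [map_sub]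
    _ ≤ κ * ‖y₀ - y₀'‖ := hPκ _
    _ ≤ κ * (2 * a * κ / σ * ‖x - x'‖) := mul_le_mul_of_nonneg_left h hκ
    _ = 2 * a * κ ^ 2 / σ * ‖x - x'‖ := by ring

end Soft

/-! ## §4 Existence of the soft background field in finite dimension from `σ > 0` alone -/

section Existence

variable {E : Type*} [NormedAddCommGroup E] [InnerProductSpace ℝ E]

/-- **A STRONG LETTER AT ONE POINT MAKES THE FUNCTION COERCIVE**: `f x₀ + ⟪p, y − x₀⟫ + (m∕2)‖y − x₀‖² ≤ f y` for all `y` with `m > 0` ⟹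
`f → +∞` along the cocompact filter. [folklore] -/
theorem tendsto_of_strongSubgradient [ProperSpace E] {f : E → ℝ} {x₀ p : E} {m : ℝ} (hm : 0 < m)
    (h : ∀ y, f x₀ + ⟪p, y - x₀⟫ + m / 2 * ‖y - x₀‖ ^ 2 ≤ f y) : Tendsto f (cocompact E) atTop := by
  -- lower bound by a function of `‖y − x₀‖` that tends to `+∞`
  have hlow : ∀ y, f x₀ - ‖p‖ * ‖y - x₀‖ + m / 2 * ‖y - x₀‖ ^ 2 ≤ f y := fun y => by
    have h1 : -(‖p‖ * ‖y - x₀‖) ≤ ⟪p, y - x₀⟫ := by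
      have := abs_real_inner_le_norm p (y - x₀); rw [abs_le] at this; linarith [this.1]
    linarith [h y]
  have hr : Tendsto (fun y : E => ‖y - x₀‖) (cocompact E) atTop := by
    have h1 : Tendsto (fun y : E => ‖y‖ + -‖x₀‖) (cocompact E) atTop :=
      tendsto_atTop_add_const_right _ _ (tendsto_norm_cocompact_atTop (E := E))
    exact tendsto_atTop_mono (fun y => by linarith [norm_sub_norm_le y x₀]) h1
  have hq : Tendsto (fun r : ℝ => f x₀ - ‖p‖ * r + m / 2 * r ^ 2) atTop atTop := by
    have e : (fun r : ℝ => f x₀ - ‖p‖ * r + m / 2 * r ^ 2) = fun r => r * (m / 2 * r - ‖p‖) + f x₀ := by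
      funext r; ring
    rw [e]
    refine tendsto_atTop_add_const_right _ _ (Tendsto.atTop_mul_atTop₀ tendsto_id ?_)
    exact tendsto_atTop_add_const_right _ _ (tendsto_id.const_mul_atTop (by positivity))
  exact tendsto_atTop_mono hlow (hq.comp hr)

variable [FiniteDimensional ℝ E]

/-- **A STRONGLY CONVEX FUNCTION ON A FINITE-DIMENSIONAL SPACE ATTAINS ITS MINIMUM** (`m > 0`): continuity from Mathlib's
`ConvexOn.continuousOn` (finite convex functions are continuous), coercivity from a strong subgradient at `0`
(`…StrongConvexSubgradientField.exists_strongSubgradient_of_strongConvexOn` BY NAME), then `Continuous.exists_forall_le`. [folklore] -/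
theorem exists_isMinOn_of_strongConvexOn {f : E → ℝ} {m : ℝ} (hm : 0 < m) (hf : StrongConvexOn univ m f) :
    ∃ x₀, IsMinOn f univ x₀ := by
  have hconv : ConvexOn ℝ univ f := hf.convexOn fun r => by positivity
  have hcont : Continuous f := continuousOn_univ.1 (hconv.continuousOn isOpen_univ)
  obtain ⟨p, hp⟩ := exists_strongSubgradient_of_strongConvexOn hf isOpen_univ (mem_univ (0 : E))
  have hco : Tendsto f (cocompact E) atTop := tendsto_of_strongSubgradient hm fun y => hp y (mem_univ y)
  obtain ⟨x₀, hx₀⟩ := hcont.exists_forall_le hco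
  exact ⟨x₀, fun y _ => hx₀ y⟩

variable {F : Type*} [NormedAddCommGroup F] [InnerProductSpace ℝ F]

/-- **THE SOFT BACKGROUND FIELD EXISTS** at every kept point, from `σ > 0` alone (`0 ≤ a`, `P` linear): SCE's displayed hypothesis
«`y₀` a soft minimiser» discharged for strongly convex `S`. [folklore] -/
theorem exists_isMinOn_soft {S : E → ℝ} {σ : ℝ} (hσ : 0 < σ) (hS : StrongConvexOn univ σ S) (P : E →ₗ[ℝ] F) {a : ℝ}
    (ha : 0 ≤ a) (x : F) : ∃ y₀ : E, IsMinOn (fun y => S y + a * ‖x - P y‖ ^ 2) univ y₀ :=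
  exists_isMinOn_of_strongConvexOn hσ (strongConvexOn_softFunctional hS P ha x)

/-- Existence and uniqueness together: the soft background field is a well-defined function of the kept variable. [folklore] -/
theorem existsUnique_isMinOn_soft {S : E → ℝ} {σ : ℝ} (hσ : 0 < σ) (hS : StrongConvexOn univ σ S) (P : E →ₗ[ℝ] F) {a : ℝ}
    (ha : 0 ≤ a) (x : F) : ∃! y₀ : E, IsMinOn (fun y => S y + a * ‖x - P y‖ ^ 2) univ y₀ := by
  obtain ⟨y₀, hy₀⟩ := exists_isMinOn_soft hσ hS P ha x
  exact ⟨y₀, hy₀, fun y₁ hy₁ => (eq_of_isMinOn_soft hσ hS P ha hy₀ hy₁).symm⟩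

end Existence

/-! ## §5 Toy (kernel): the letters are jointly inhabited -/

/-- `E = F`, `P = id`, `κ = 1`: the END specialises to `‖y₀ − y₀′‖ ≤ (2a∕σ)‖x − x′‖` for any `σ`-strongly convex `S` — e.g. `S = ½σ‖·‖²`,
where `y₀(x) = (2a∕(σ + 2a))·x` and the true constant is `2a∕(σ + 2a) ≤ 2a∕σ`. -/
example {F : Type*} [NormedAddCommGroup F] [InnerProductSpace ℝ F] {S : F → ℝ} {σ a : ℝ} (hσ : 0 < σ) (ha : 0 ≤ a)
    (hS : StrongConvexOn univ σ S) {x x' y₀ y₀' : F}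
    (hy₀ : IsMinOn (fun y => S y + a * ‖x - LinearMap.id (R := ℝ) y‖ ^ 2) univ y₀)
    (hy₀' : IsMinOn (fun y => S y + a * ‖x' - LinearMap.id (R := ℝ) y‖ ^ 2) univ y₀') :
    ‖y₀ - y₀'‖ ≤ 2 * a * 1 / σ * ‖x - x'‖ :=
  norm_sub_le_of_isMinOn_soft hσ hS LinearMap.id zero_le_one (fun y => by simp) ha hy₀ hy₀'

end Summit.QuantumFields.BalabanUV.T4Continuum.NE7b.SoftStepBackgroundLipschitz

end
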